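import Literature.MathematicalPhysics.QuantumFieldTheory.Balaban1983to89.B12RegularSpaces111Mono
import Literature.MathematicalPhysics.QuantumFieldTheory.Balaban1983to89.B14Radii

/-!
# `Balaban1983to89.B14RegularSpaces234` — T. Bałaban, *Convergent renormalization expansions for lattice gauge
theories*, Commun. Math. Phys. **119** (1988) 243–285 [Balaban1988Convergent]: the multi-scale analyticity spaces
`Ũ^c_j(X, α̃₀, α̃₁)` of §2 p. 261, (2.34)–(2.39) — the three conditions (i)–(iii) as SEPARATE CONCRETE membership predicates
over the carriers of the single-scale spaces of [I] (`B12RegularSpaces111`) and the LANDED radii `B14Radii.rad234 … rad239`, the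
space as the SET of pairs `(𝐔, 𝐉)` satisfying them; PROVED: monotonicity in the sequences `α̃₀, α̃₁` (hence the «slightly larger
spaces» of p. 262 and of (3.43) p. 276 contain the original ones); siblings: `B14RegularSpaces234Inner` (innermost-layer reduction to
(I.1.11)–(I.1.14), non-vacuity), `B14RegularSpaces234Gauge` (invariance under `G`-valued gauge transformations)

HONEST FRAMING (cell `lit-balaban`, verbatim): statement-level skeleton of published theorems with citation tags; proofs where landed; nothing here is a claim about the Yang–Mills mass gap.

PDF held: `paper:balaban1988-cmp119-convergent-renormalization` (journal page = PDF page + 242); read from the page renders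
`b2b-balaban-ref1/pages/1988-cmp119-convergent-renormalization/…-p018-x2.png` (p. 260), `…-p019-x2.png` (p. 261), `…-p020-x2.png`
(p. 262), `…-p013/p014/p015-x2.png` (pp. 255–257: (2.2), (2.10)–(2.16)), as images.

WHAT IS REPRODUCED.  SKELETON row `B14.Def@261` («(2.34)–(2.39): the space Ũ^c_j(X, α̃₀, α̃₁), β = 1/4»), until now carried by the
RADII alone (`B14Radii`, typed verbatim + arithmetic PROVED) and by the abstract set `Step.LFTower.spaceB` (DIVERGENCE D-f2.7) — the
DEFINITIONS steward's gap A2, B14 half (r20 `DEFINITIONS.md`: «the regular spaces 𝐔ᶜ_j … (B12 (1.11)–(1.16), B14 (2.34)–(2.39)) as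
CONCRETE membership predicates on (𝐔, 𝐉)»; the B12 half is `B12RegularSpaces111`, p245800).

THE PRINT, verbatim (pp. 260–261).  *«The terms of 𝐁_k are analytic functions of the variables (𝐔, 𝐉) introduced in the same way as in
the regular cases before. The analyticity domains are spaces defined similarly as in (I.1.11)–(I.1.16), but now we must take into
account the existence of many different scales. We introduce the following definition.  The space Ũ^c_j(X, α̃₀, α̃₁) for X ∈ 𝐃_j is
the set of configurations (𝐔, 𝐉) defined on X and satisfying the three conditions below.  (i) 𝐔 = U′U, U has values in the group G,
and the configurations U, 𝐔, U_{p,X}(M˙(𝐔)) = U(𝐁_p(X)∪{Γ_i}_{i<p}, M˙(𝐔)), 𝐉, 𝐉_{p,X}(M˙(𝐔)) satisfy the bounds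
|∂U − 1|, |∂𝐔 − 1| < (1 − β(1 − 2^{−(j−n)}))α_{0,n}ξ²(Lⁿξ)^{−2}, (2.34)  |∂U_{p,X}(M˙(𝐔)) − 1| < (1 − β(1 − 2^{−(j−n)}))α_{0,n}L^{−2p}(LⁿL^{−p})^{−2}, (2.35)
|𝐉| < (1 − β(1 − 2^{−(j−n)}))α_{0,n}(Lⁿξ)^{−3}, (2.36)  |𝐉_{p,X}(M˙(𝐔))| < (1 − β(1 − 2^{−(j−n)}))α_{0,n}L^{n−min{p,n}}(LⁿL^{−p})^{−3}, (2.37)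
on X∩(Ω_n∖Ω_{n+1}) for n = 1, …, j−1, or on X∩Ω_j for n = j.  (ii) For each cube □ ⊂ Ω_n∖Ω_{n+2}, □∩Ω^c_{n+1} ≠ ∅, n = 1, …, j−1, of
the size CMLⁿξ, or □ ⊂ Ω_j and of the size CM, there exists a gauge transformation u defined on □∩X and such, that
U^u = exp iξA, Lⁿξ|A|, (Lⁿξ)²|∇^ξA| < BCMα_{0,n} (2.38) on □∩X, with an absolute constant B.  (iii) U′ = exp iξA′, A′ has values in the
algebra 𝔤ᶜ,  Lⁿξ|A′|, (Lⁿξ)²|∇^ξ_U A′| < (1 − β(1 − 2^{−(j−n)}))α_{1,n} (2.39) on X∩(Ω_n∖Ω_{n+1}) for n = 1, …, j−1, or on X∩Ω_j for n = j.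
The number β is a small positive constant, but not too small, e.g., we can take β = 1/4. The spaces defined above are invariant with
respect to G-valued gauge transformations. This definition gives a more detailed and precise form, suitable for our inductive
constructions, of the regularity conditions for background fields, introduced in [13–15].»*  p. 262: *«the newly created expressions
E^{(k)}, 𝐑^{(k)}, 𝐁^{(k)} are defined on slightly larger spaces, with the coefficients in their definition bigger by β multiplied by a
corresponding number»*; p. 276 (3.43): *«… replaced by the space Ũ^c_{k+1}(Y, (1+β)α̃₀, (1+β)α̃₁) × {A : …}»*.  pp. 256–257: *«Consider a
domain Ω such that it is a union of M₁-cubes in the lattice T_ξ, ξ = L^{−j}. For this domain we build a minimal determining set with a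
support in Ω … We denote this determining set by 𝐁_j(Ω), and the corresponding minimal configurations by U(𝐁_j(Ω), ·) = U_{j,Ω}(·). (2.13)»*.

THE TYPING (carriers OF RECORD, nothing re-declared).  (a) As in `B12RegularSpaces111`: pairs `(𝐔, 𝐉) = Setup.FieldPair P i 𝔸ˣ 𝔸` at
a lattice level `i` (the `ξ`-lattice, `ξ = L^{−j}`), values in a complete normed `ℂ`-algebra `𝔸` with the three value data `G ≤ Gᶜ ≤ 𝔸ˣ`,
`𝔤ᶜ ≤ 𝔸` of `B12RegularSpaces111.Model`; `∂U(p)` = `B12RegularSpaces111.plaq`, `U^u` = `gaugeU`, `R(u)𝐉` = `adJ`, `(𝐔, 𝐉)^u` = `act`,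
`∇^ξ_U` = `nabla`, `∇^ξ` = `grad`, `exp iξA` = `expI`, `𝐔 = (exp iξA′)U` = `Factors`; the sequences `α̃₀ = {α_{0,n}}`, `α̃₁ = {α_{1,n}}` are
functions `ℕ → ℝ`; the radii ARE `B14Radii.rad234, rad235, rad236, rad237, rad238, rad239` (p240…, unit `b2b-balaban-pv02`), fed with
`β`, `α_{0,n}`/`α_{1,n}`, `ξ`, `L`, `j`, `n`, `p` and, for (2.38), `B, C, M`; the printed LEFT sides of (2.38), (2.39) keep their factors
`Lⁿξ`, `(Lⁿξ)²`.  (b) GEOMETRY AS DATA (DIVERGENCE F5, as in `B12RegularSpaces111.Frame`): an `MSFrame` for `X ∈ 𝐃_j` = the region `X`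
(where the value clauses «on X» live), the LAYER regions `n ↦ X∩(Ω_n∖Ω_{n+1})` (`1 ≤ n < j`) / `X∩Ω_j` (`n = j`), the families of cubes
`n ↦ {□∩X}` of (ii), and the functions of (i): `𝐔 ↦ U_{p,X}(M˙(𝐔))`, `𝐔 ↦ 𝐉_{p,X}(M˙(𝐔))` (`MSBackgroundFns`: the minimal configurations
(2.12)–(2.13) of the determining sets `𝐁_p(X)∪{Γ_i}_{i<p}` composed with the averages `M˙` — constructions of [15] and of (2.10)–(2.16),
carried as DATA exactly as `B12RegularSpaces111.BackgroundFns` carries `U_n(M˙(·))`), each on ITS OWN lattice level `lvl p` (the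
`L^{−p}`-lattice of (2.13): (2.35) is (2.34) with `ξ` replaced by `L^{−p}`) together with the layer regions of that lattice.  (c) The three
conditions are the `Prop`-valued structures `CondI234` ((i): «U ∈ G» on `X`, (2.34) for `U` and for `𝐔`, (2.35), (2.36), (2.37)),
`CondII238` ((ii)), `CondIII239` ((iii)); `Satisfies234` = «(𝐔, 𝐉) satisfy (i)–(iii)» with the factorisation witnesses `U, A′` existentially
bound and the value clauses `𝐔 ∈ Gᶜ`, `𝐉 ∈ 𝔤ᶜ` on `X` of [I] p. 262; **`space234` = `Ũ^c_j(X, α̃₀, α̃₁)`** = the SET of such pairs (print: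
«is the set of configurations», not a union of orbits as in [I]); `towerSpaceB` = the same family in the shape of `Step.LFTower.spaceB`.
READINGS made explicit (none changes a printed bound): the index `p` of (2.35), (2.37) is not delimited in print — typed `1 ≤ p ≤ j` as in
(I.1.15); the `u` of (ii) is typed `G`-valued as in (I.1.12) («defined on □∩X»: its values off `□∩X` are never used); the cube sizes and the
domains `Ω_n` enter only through the data.  PROVED here: `condI234_mono` … `space234_mono` (monotone in `α̃₀, α̃₁` pointwise, for
`0 ≤ β ≤ 1`, `L, ξ > 0`, `BCM ≥ 0`), `space234_subset_enlarged` (p. 262 / (3.43)).  In the sibling `B14RegularSpaces234Inner`: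
`satisfiesI_III_inner` (at the innermost layer `n = j`, `Lʲξ = 1`, (i)–(iii) give (I.1.11)–(I.1.14) = `B12RegularSpaces111.SatisfiesI_III`
with `(α₀, α₁, γ₀) = (α_{0,j}, α_{1,j}, α_{0,j})`), `unitPair_mem_space234` (non-vacuity); in the sibling `B14RegularSpaces234Gauge` (proof
lane): the p. 261 sentence «invariant with respect to G-valued gauge transformations».  NOT here: the constructions `𝐁_p(X)`, `M˙`, `U(𝐁, ·)` (data; rows B14.Eq2.10–2.16, `B15DeterminingSets`),
analyticity of anything, the choice `β = 1/4` (a letter).  No `Prop` placeholder, no new fact; axioms standard.  Unit `lit-balaban-p07`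
(Phase-2 seat p07 gen 3; TAKING line HOME/STATUS.md 2026-08-21T03:50:00Z), HOME `run/shared/lean/pub/lit-balaban/`.
-/

namespace Literature.MathematicalPhysics.QuantumFieldTheory.Balaban1983to89.B14RegularSpaces234

open Literature.MathematicalPhysics.QuantumFieldTheory.Balaban1983to89
open Literature.MathematicalPhysics.QuantumFieldTheory.Balaban1983to89.B12RegularSpaces111
open Literature.MathematicalPhysics.QuantumFieldTheory.Balaban1983to89.B14Radii
open Complex

noncomputable section

/-! ## §1. Multi-scale geometry and the functions of (i) AS DATA; the constants -/

/-- The functions of condition (i), p. 261: `𝐔 ↦ U_{p,X}(M˙(𝐔)) = U(𝐁_p(X)∪{Γ_i}_{i<p}, M˙(𝐔))` and `𝐔 ↦ 𝐉_{p,X}(M˙(𝐔))` — minimal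
configurations (2.12)–(2.13) of determining sets built in the lattice `T_{L^{−p}}` (p. 256–257), composed with the averages `M˙` (2.11) —
carried as DATA, each on its own lattice level `lvl p` (for `Setup`'s tori the `L^{−p}`-lattice seen from the `ξ`-lattice at level `i` is
level `i + (j − p)`), together with the layer regions `X∩(Ω_n∖Ω_{n+1})` / `X∩Ω_j` of THAT lattice, on which (2.35), (2.37) are imposed.
[cite: Balaban1988Convergent, (2.35) p.261] -/
structure MSBackgroundFns (P : Params) (i : ℕ) (𝔸 : Type*) [Monoid 𝔸] where
  /-- the lattice level carrying `U_{p,X}`, `𝐉_{p,X}` -/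
  lvl : ℕ → ℕ
  /-- `𝐔 ↦ U_{p,X}(M˙(𝐔))` -/
  Up : (p : ℕ) → (PBond P i → 𝔸ˣ) → PBond P (lvl p) → 𝔸ˣ
  /-- `𝐔 ↦ 𝐉_{p,X}(M˙(𝐔))` -/
  Jp : (p : ℕ) → (PBond P i → 𝔸ˣ) → PBond P (lvl p) → 𝔸
  /-- `(p, n) ↦ X∩(Ω_n∖Ω_{n+1})` (`n < j`), `X∩Ω_j` (`n = j`), in the lattice of `U_{p,X}` -/
  layer : (p n : ℕ) → Region P (lvl p)

/-- Everything the definition of `Ũ^c_j(X, α̃₀, α̃₁)` uses about `X ∈ 𝐃_j` and the sequence `{Ω_n}`: the region `X` («defined on X»,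
«U has values in the group G», «A′ has values in the algebra 𝔤ᶜ»), the layers `X∩(Ω_n∖Ω_{n+1})`, `n = 1, …, j−1`, `X∩Ω_j` (`n = j`) of
(2.34), (2.36), (2.39), the cubes of (ii) («□ ⊂ Ω_n∖Ω_{n+2}, □∩Ω^c_{n+1} ≠ ∅ … of the size CMLⁿξ, or □ ⊂ Ω_j and of the size CM»,
intersected with `X`), and the functions of (i). Geometry is data (DIVERGENCE F5). [cite: Balaban1988Convergent, (2.34)-(2.39) p.261] -/
structure MSFrame (P : Params) (i : ℕ) (𝔸 : Type*) [Monoid 𝔸] where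
  /-- the localization domain `X` -/
  X : Region P i
  /-- `n ↦ X∩(Ω_n∖Ω_{n+1})` (`1 ≤ n < j`), `X∩Ω_j` (`n = j`) -/
  layer : ℕ → Region P i
  /-- `n ↦` the regions `□∩X`, `□` the cubes of (ii) at layer `n` -/
  cubes : ℕ → Set (Region P i)
  /-- `U_{p,X}(M˙(·))`, `𝐉_{p,X}(M˙(·))` with their lattices and layers -/
  bg : MSBackgroundFns P i 𝔸

/-- The constants of the `j`-th multi-scale space: `j`, `ξ = L^{−j}`, `L`, the number `β` of (2.34)–(2.39) («e.g., we can take β = 1/4»),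
and the three constants `B` («an absolute constant»), `C`, `M` of (2.38). [cite: Balaban1988Convergent, (2.38) p.261] -/
structure MSConsts where
  /-- `j` -/
  j : ℕ
  /-- `ξ = L^{−j}` -/
  ξ : ℝ
  /-- `L` -/
  L : ℝ
  /-- `β` -/
  β : ℝ
  /-- `B` -/
  B : ℝ
  /-- `C` -/
  C : ℝ
  /-- `M` -/
  M : ℝ

/-- The single-scale constants of [I] underlying the multi-scale ones: `(j, ξ, L, O(1)LMB := BCM)` (the factorisation `𝐔 = (exp iξA′)U`
and the innermost-layer comparison with (I.1.11)–(I.1.14) use them). [cite: Balaban1988Convergent, (2.38) p.261] -/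
def MSConsts.toStepConsts (c : MSConsts) : StepConsts where
  j := c.j
  ξ := c.ξ
  L := c.L
  cB := c.B * c.C * c.M

/-- The constants over `Setup.Params`: `ξ = Params.eta j = L^{−j}`, `L = Params.L`. [cite: Balaban1988Convergent, (2.34) p.261] -/
def MSConsts.ofParams (P : Params) (β B C M : ℝ) (j : ℕ) : MSConsts where
  j := j
  ξ := P.eta j
  L := P.L
  β := β
  B := B
  C := C
  M := M

/-! ## §2. The three conditions (i)–(iii), (2.34)–(2.39) -/

section Conditions

variable {P : Params} {i : ℕ} {𝔸 : Type*} [NormedRing 𝔸] [NormedAlgebra ℂ 𝔸] [CompleteSpace 𝔸]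
variable (𝓜 : Model 𝔸)

/-- **Condition (i)** for the `G`-valued factor `U` of `𝐔 = U′U` and the pair `(𝐔, 𝐉)`: «U has values in the group G, and the
configurations U, 𝐔, U_{p,X}(M˙(𝐔)), 𝐉, 𝐉_{p,X}(M˙(𝐔)) satisfy the bounds (2.34)–(2.37) on X∩(Ω_n∖Ω_{n+1}) for n = 1, …, j−1, or on
X∩Ω_j for n = j» (radii `B14Radii.rad234 … rad237`; `p` typed `1 ≤ p ≤ j` as in (I.1.15)). [cite: Balaban1988Convergent, (2.34)-(2.37) p.261] -/
structure CondI234 (F : MSFrame P i 𝔸) (c : MSConsts) (α₀ : ℕ → ℝ) (U : PBond P i → 𝔸ˣ) (Φ : FieldPair P i 𝔸ˣ 𝔸) :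
    Prop where
  /-- «U has values in the group G» (on `X`) -/
  gValued : ∀ b ∈ F.X.bonds, U b ∈ 𝓜.G
  /-- (2.34) for `U`: `|∂U − 1| < (1 − β(1 − 2^{−(j−n)}))α_{0,n}ξ²(Lⁿξ)^{−2}` on layer `n` -/
  plaq_lt : ∀ n, 1 ≤ n → n ≤ c.j → ∀ p ∈ (F.layer n).plaqs,
    ‖(↑(plaq U p) : 𝔸) - 1‖ < rad234 c.β (α₀ n) c.ξ c.L c.j n
  /-- (2.34) for `𝐔` -/
  plaqU_lt : ∀ n, 1 ≤ n → n ≤ c.j → ∀ p ∈ (F.layer n).plaqs,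
    ‖(↑(plaq Φ.U p) : 𝔸) - 1‖ < rad234 c.β (α₀ n) c.ξ c.L c.j n
  /-- (2.35): `|∂U_{p,X}(M˙(𝐔)) − 1| < (1 − β(1 − 2^{−(j−n)}))α_{0,n}L^{−2p}(LⁿL^{−p})^{−2}` on layer `n` of the lattice of `U_{p,X}` -/
  plaqP_lt : ∀ p, 1 ≤ p → p ≤ c.j → ∀ n, 1 ≤ n → n ≤ c.j → ∀ q ∈ (F.bg.layer p n).plaqs,
    ‖(↑(plaq (F.bg.Up p Φ.U) q) : 𝔸) - 1‖ < rad235 c.β (α₀ n) c.L c.j n p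
  /-- (2.36): `|𝐉| < (1 − β(1 − 2^{−(j−n)}))α_{0,n}(Lⁿξ)^{−3}` on layer `n` -/
  J_lt : ∀ n, 1 ≤ n → n ≤ c.j → ∀ b ∈ (F.layer n).bonds, ‖Φ.J b‖ < rad236 c.β (α₀ n) c.ξ c.L c.j n
  /-- (2.37): `|𝐉_{p,X}(M˙(𝐔))| < (1 − β(1 − 2^{−(j−n)}))α_{0,n}L^{n−min{p,n}}(LⁿL^{−p})^{−3}` on layer `n` of the lattice of `𝐉_{p,X}` -/
  JP_lt : ∀ p, 1 ≤ p → p ≤ c.j → ∀ n, 1 ≤ n → n ≤ c.j → ∀ b ∈ (F.bg.layer p n).bonds,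
    ‖F.bg.Jp p Φ.U b‖ < rad237 c.β (α₀ n) c.L c.j n p

/-- **Condition (ii)** for the factor `U`: «For each cube □ … there exists a gauge transformation u defined on □∩X and such, that
U^u = exp iξA, Lⁿξ|A|, (Lⁿξ)²|∇^ξA| < BCMα_{0,n} (2.38) on □∩X, with an absolute constant B» (radius `B14Radii.rad238`, NO factor
`(1 − β(1 − 2^{−(j−n)}))`, as printed; `u` typed `G`-valued as in (I.1.12), everywhere defined — its values off `□∩X` are never used).
[cite: Balaban1988Convergent, (2.38) p.261] -/
structure CondII238 (F : MSFrame P i 𝔸) (c : MSConsts) (α₀ : ℕ → ℝ) (U : PBond P i → 𝔸ˣ) : Prop where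
  /-- (2.38) on every cube `□∩X` of every layer `n = 1, …, j` -/
  localGauge : ∀ n, 1 ≤ n → n ≤ c.j → ∀ C ∈ F.cubes n, ∃ u : Site P i → 𝔸ˣ, (∀ x, u x ∈ 𝓜.G) ∧ ∃ A : PBond P i → 𝔸,
    (∀ b ∈ C.bonds, gaugeU u U b = expI c.ξ (A b)) ∧
      (∀ b ∈ C.bonds, c.L ^ n * c.ξ * ‖A b‖ < rad238 c.B c.C c.M (α₀ n)) ∧
        ∀ q ∈ C.dpairs, (c.L ^ n * c.ξ) ^ 2 * ‖grad c.ξ q.2.1 (fun y => A ⟨y, q.2.2⟩) q.1‖ < rad238 c.B c.C c.M (α₀ n)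

/-- **Condition (iii)** for the algebra-valued `A′` of `U′ = exp iξA′` (covariant derivative in the background `U`): «A′ has values in the
algebra 𝔤ᶜ, Lⁿξ|A′|, (Lⁿξ)²|∇^ξ_U A′| < (1 − β(1 − 2^{−(j−n)}))α_{1,n} (2.39) on X∩(Ω_n∖Ω_{n+1}) for n = 1, …, j−1, or on X∩Ω_j for n = j»
(radius `B14Radii.rad239`). [cite: Balaban1988Convergent, (2.39) p.261] -/
structure CondIII239 (F : MSFrame P i 𝔸) (c : MSConsts) (α₁ : ℕ → ℝ) (U : PBond P i → 𝔸ˣ) (A' : PBond P i → 𝔸) : Prop where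
  /-- «A′ has values in the algebra 𝔤ᶜ» (on `X`) -/
  gcValued : ∀ b ∈ F.X.bonds, A' b ∈ 𝓜.gc
  /-- `Lⁿξ|A′| < (1 − β(1 − 2^{−(j−n)}))α_{1,n}` on layer `n` -/
  norm_lt : ∀ n, 1 ≤ n → n ≤ c.j → ∀ b ∈ (F.layer n).bonds, c.L ^ n * c.ξ * ‖A' b‖ < rad239 c.β (α₁ n) c.j n
  /-- `(Lⁿξ)²|∇^ξ_U A′| < (1 − β(1 − 2^{−(j−n)}))α_{1,n}` on layer `n` -/
  nabla_lt : ∀ n, 1 ≤ n → n ≤ c.j → ∀ q ∈ (F.layer n).dpairs,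
    (c.L ^ n * c.ξ) ^ 2 * ‖nabla c.ξ U q.2.1 (fun y => A' ⟨y, q.2.2⟩) q.1‖ < rad239 c.β (α₁ n) c.j n

/-- «configurations (𝐔, 𝐉) defined on X and satisfying the three conditions» (i)–(iii) with the sequences `α̃₀ = {α_{0,n}}`,
`α̃₁ = {α_{1,n}}`: `𝐔` is `Gᶜ`-valued and `𝐉` is `𝔤ᶜ`-valued on `X` («the variables (𝐔, 𝐉) introduced in the same way as in the regular
cases before», [I] p. 262), and for some factorisation `𝐔 = (exp iξA′)U` («𝐔 = U′U», «U′ = exp iξA′») conditions (i), (ii), (iii) hold.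
[cite: Balaban1988Convergent, (2.34)-(2.39) p.261] -/
def Satisfies234 (F : MSFrame P i 𝔸) (c : MSConsts) (α₀ α₁ : ℕ → ℝ) (Φ : FieldPair P i 𝔸ˣ 𝔸) : Prop :=
  (∀ b ∈ F.X.bonds, Φ.U b ∈ 𝓜.Gc) ∧ (∀ b ∈ F.X.bonds, Φ.J b ∈ 𝓜.gc) ∧
    ∃ (U : PBond P i → 𝔸ˣ) (A' : PBond P i → 𝔸), Factors c.toStepConsts Φ.U U A' ∧
      CondI234 𝓜 F c α₀ U Φ ∧ CondII238 𝓜 F c α₀ U ∧ CondIII239 𝓜 F c α₁ U A'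

/-! ## §3. The space `Ũ^c_j(X, α̃₀, α̃₁)` -/

/-- **The space `Ũ^c_j(X, α̃₀, α̃₁)`**: «the set of configurations (𝐔, 𝐉) defined on X and satisfying the three conditions below»
(i)–(iii). [cite: Balaban1988Convergent, (2.34)-(2.39) p.261] -/
def space234 (F : MSFrame P i 𝔸) (c : MSConsts) (α₀ α₁ : ℕ → ℝ) : Set (FieldPair P i 𝔸ˣ 𝔸) :=
  {Φ | Satisfies234 𝓜 F c α₀ α₁ Φ}

/-- The same family in the shape of the abstract carrier `Step.LFTower.spaceB : (j : ℕ) → (sys j).Dom → Set Φ` (the tower's field for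
«(ii) it has an extension to an analytic function on the space Ũ^c_j(X, α̃₀, α̃₁)», p. 261), for any assignment of multi-scale frames and
constants to the localization domains `X ∈ 𝐃_j`. [cite: Balaban1988Convergent, (2.41) p.261] -/
def towerSpaceB {Dom : ℕ → Type*} (F : (j : ℕ) → Dom j → MSFrame P i 𝔸) (c : ℕ → MSConsts) (α₀ α₁ : ℕ → ℝ) (j : ℕ)
    (X : Dom j) : Set (FieldPair P i 𝔸ˣ 𝔸) :=
  space234 𝓜 (F j X) (c j) α₀ α₁

variable {𝓜}

/-- Membership in `Ũ^c_j(X, α̃₀, α̃₁)` IS «satisfying the three conditions». [cite: Balaban1988Convergent, (2.34)-(2.39) p.261] -/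
theorem mem_space234_iff {F : MSFrame P i 𝔸} {c : MSConsts} {α₀ α₁ : ℕ → ℝ} (Φ : FieldPair P i 𝔸ˣ 𝔸) :
    Φ ∈ space234 𝓜 F c α₀ α₁ ↔ Satisfies234 𝓜 F c α₀ α₁ Φ :=
  Iff.rfl

/-! ## §4. Monotonicity in the sequences `α̃₀, α̃₁`; the enlarged spaces of p. 262 and (3.43) -/

/-- For `0 ≤ β ≤ 1` the factors `1 − β(1 − 2^{−m})` are nonnegative (`B14Radii.one_sub_le_shrink`). [cite: Balaban1988Convergent, (2.34) p.261] -/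
theorem shrink_nonneg {β : ℝ} (h0 : 0 ≤ β) (h1 : β ≤ 1) (m : ℕ) : 0 ≤ shrink β m :=
  le_trans (by linarith) (one_sub_le_shrink h0 m)

/-- The printed radii are monotone in the coefficient `α_{0,n}` / `α_{1,n}` (nonnegative factor, `L, ξ > 0`): (2.34).
[cite: Balaban1988Convergent, (2.34) p.261] -/
theorem rad234_mono {β a a' ξ L : ℝ} {j n : ℕ} (hs : 0 ≤ shrink β (j - n)) (hL : 0 < L) (hξ : 0 < ξ) (ha : a ≤ a') :
    rad234 β a ξ L j n ≤ rad234 β a' ξ L j n := by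
  unfold rad234
  have h1 : 0 ≤ ξ ^ 2 := sq_nonneg _
  have h2 : 0 ≤ (L ^ n * ξ) ^ (-2 : ℤ) := zpow_nonneg (by positivity) _
  exact mul_le_mul_of_nonneg_right (mul_le_mul_of_nonneg_right (mul_le_mul_of_nonneg_left ha hs) h1) h2

/-- (2.35) is monotone in `α_{0,n}`. [cite: Balaban1988Convergent, (2.35) p.261] -/
theorem rad235_mono {β a a' L : ℝ} {j n p : ℕ} (hs : 0 ≤ shrink β (j - n)) (hL : 0 < L) (ha : a ≤ a') :
    rad235 β a L j n p ≤ rad235 β a' L j n p := by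
  unfold rad235
  have h1 : 0 ≤ L ^ (-(2 * (p : ℤ))) := zpow_nonneg hL.le _
  have h2 : 0 ≤ (L ^ n * L ^ (-(p : ℤ))) ^ (-2 : ℤ) := zpow_nonneg (mul_nonneg (by positivity) (zpow_nonneg hL.le _)) _
  exact mul_le_mul_of_nonneg_right (mul_le_mul_of_nonneg_right (mul_le_mul_of_nonneg_left ha hs) h1) h2

/-- (2.36) is monotone in `α_{0,n}`. [cite: Balaban1988Convergent, (2.36) p.261] -/
theorem rad236_mono {β a a' ξ L : ℝ} {j n : ℕ} (hs : 0 ≤ shrink β (j - n)) (hL : 0 < L) (hξ : 0 < ξ) (ha : a ≤ a') :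
    rad236 β a ξ L j n ≤ rad236 β a' ξ L j n := by
  unfold rad236
  have h2 : 0 ≤ (L ^ n * ξ) ^ (-3 : ℤ) := zpow_nonneg (by positivity) _
  exact mul_le_mul_of_nonneg_right (mul_le_mul_of_nonneg_left ha hs) h2

/-- (2.37) is monotone in `α_{0,n}`. [cite: Balaban1988Convergent, (2.37) p.261] -/
theorem rad237_mono {β a a' L : ℝ} {j n p : ℕ} (hs : 0 ≤ shrink β (j - n)) (hL : 0 < L) (ha : a ≤ a') :
    rad237 β a L j n p ≤ rad237 β a' L j n p := by
  unfold rad237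
  have h1 : 0 ≤ L ^ ((n : ℤ) - ((min p n : ℕ) : ℤ)) := zpow_nonneg hL.le _
  have h2 : 0 ≤ (L ^ n * L ^ (-(p : ℤ))) ^ (-3 : ℤ) := zpow_nonneg (mul_nonneg (by positivity) (zpow_nonneg hL.le _)) _
  exact mul_le_mul_of_nonneg_right (mul_le_mul_of_nonneg_right (mul_le_mul_of_nonneg_left ha hs) h1) h2

/-- (2.38) is monotone in `α_{0,n}` (`BCM ≥ 0`). [cite: Balaban1988Convergent, (2.38) p.261] -/
theorem rad238_mono {B C M a a' : ℝ} (hBCM : 0 ≤ B * C * M) (ha : a ≤ a') : rad238 B C M a ≤ rad238 B C M a' :=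
  mul_le_mul_of_nonneg_left ha hBCM

/-- (2.39) is monotone in `α_{1,n}`. [cite: Balaban1988Convergent, (2.39) p.261] -/
theorem rad239_mono {β a a' : ℝ} {j n : ℕ} (hs : 0 ≤ shrink β (j - n)) (ha : a ≤ a') : rad239 β a j n ≤ rad239 β a' j n :=
  mul_le_mul_of_nonneg_left ha hs

omit [CompleteSpace 𝔸] in
/-- (i) with `α̃₀` implies (i) with `α̃₀′ ≥ α̃₀` pointwise (`0 ≤ β ≤ 1`, `L, ξ > 0`). [cite: Balaban1988Convergent, (2.34)-(2.37) p.261] -/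
theorem condI234_mono {F : MSFrame P i 𝔸} {c : MSConsts} (h0 : 0 ≤ c.β) (h1 : c.β ≤ 1) (hL : 0 < c.L) (hξ : 0 < c.ξ)
    {α₀ α₀' : ℕ → ℝ} (hα : ∀ n, α₀ n ≤ α₀' n) {U : PBond P i → 𝔸ˣ} {Φ : FieldPair P i 𝔸ˣ 𝔸} (h : CondI234 𝓜 F c α₀ U Φ) :
    CondI234 𝓜 F c α₀' U Φ := by
  have hs : ∀ n, 0 ≤ shrink c.β (c.j - n) := fun n => shrink_nonneg h0 h1 _
  refine ⟨h.gValued, fun n hn hnj p hp => (h.plaq_lt n hn hnj p hp).trans_le (rad234_mono (hs n) hL hξ (hα n)),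
    fun n hn hnj p hp => (h.plaqU_lt n hn hnj p hp).trans_le (rad234_mono (hs n) hL hξ (hα n)),
    fun p hp hpj n hn hnj q hq => (h.plaqP_lt p hp hpj n hn hnj q hq).trans_le (rad235_mono (hs n) hL (hα n)),
    fun n hn hnj b hb => (h.J_lt n hn hnj b hb).trans_le (rad236_mono (hs n) hL hξ (hα n)),
    fun p hp hpj n hn hnj b hb => (h.JP_lt p hp hpj n hn hnj b hb).trans_le (rad237_mono (hs n) hL (hα n))⟩

/-- (ii) with `α̃₀` implies (ii) with `α̃₀′ ≥ α̃₀` pointwise (`BCM ≥ 0`): the same `u`, the same `A`. [cite: Balaban1988Convergent, (2.38) p.261] -/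
theorem condII238_mono {F : MSFrame P i 𝔸} {c : MSConsts} (hBCM : 0 ≤ c.B * c.C * c.M) {α₀ α₀' : ℕ → ℝ}
    (hα : ∀ n, α₀ n ≤ α₀' n) {U : PBond P i → 𝔸ˣ} (h : CondII238 𝓜 F c α₀ U) : CondII238 𝓜 F c α₀' U := by
  refine ⟨fun n hn hnj C hC => ?_⟩
  obtain ⟨u, hu, A, hgauge, hA, hdA⟩ := h.localGauge n hn hnj C hC
  exact ⟨u, hu, A, hgauge, fun b hb => (hA b hb).trans_le (rad238_mono hBCM (hα n)),
    fun q hq => (hdA q hq).trans_le (rad238_mono hBCM (hα n))⟩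

omit [CompleteSpace 𝔸] in
/-- (iii) with `α̃₁` implies (iii) with `α̃₁′ ≥ α̃₁` pointwise (`0 ≤ β ≤ 1`). [cite: Balaban1988Convergent, (2.39) p.261] -/
theorem condIII239_mono {F : MSFrame P i 𝔸} {c : MSConsts} (h0 : 0 ≤ c.β) (h1 : c.β ≤ 1) {α₁ α₁' : ℕ → ℝ}
    (hα : ∀ n, α₁ n ≤ α₁' n) {U : PBond P i → 𝔸ˣ} {A' : PBond P i → 𝔸} (h : CondIII239 𝓜 F c α₁ U A') :
    CondIII239 𝓜 F c α₁' U A' := by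
  have hs : ∀ n, 0 ≤ shrink c.β (c.j - n) := fun n => shrink_nonneg h0 h1 _
  exact ⟨h.gcValued, fun n hn hnj b hb => (h.norm_lt n hn hnj b hb).trans_le (rad239_mono (hs n) (hα n)),
    fun n hn hnj q hq => (h.nabla_lt n hn hnj q hq).trans_le (rad239_mono (hs n) (hα n))⟩

/-- (i)–(iii) are monotone in `(α̃₀, α̃₁)` pointwise (`0 ≤ β ≤ 1`, `L, ξ > 0`, `BCM ≥ 0`). [cite: Balaban1988Convergent, (2.34)-(2.39) p.261] -/
theorem satisfies234_mono {F : MSFrame P i 𝔸} {c : MSConsts} (h0 : 0 ≤ c.β) (h1 : c.β ≤ 1) (hL : 0 < c.L) (hξ : 0 < c.ξ)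
    (hBCM : 0 ≤ c.B * c.C * c.M) {α₀ α₀' α₁ α₁' : ℕ → ℝ} (hα₀ : ∀ n, α₀ n ≤ α₀' n) (hα₁ : ∀ n, α₁ n ≤ α₁' n)
    {Φ : FieldPair P i 𝔸ˣ 𝔸} (h : Satisfies234 𝓜 F c α₀ α₁ Φ) : Satisfies234 𝓜 F c α₀' α₁' Φ := by
  obtain ⟨hG, hg, U, A', hf, h1', h2', h3'⟩ := h
  exact ⟨hG, hg, U, A', hf, condI234_mono h0 h1 hL hξ hα₀ h1', condII238_mono hBCM hα₀ h2', condIII239_mono h0 h1 hα₁ h3'⟩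

/-- **The spaces are monotone in the sequences**: `Ũ^c_j(X, α̃₀, α̃₁) ⊆ Ũ^c_j(X, α̃₀′, α̃₁′)` for `α̃₀ ≤ α̃₀′`, `α̃₁ ≤ α̃₁′` pointwise
(`0 ≤ β ≤ 1`, `L, ξ > 0`, `BCM ≥ 0`). [cite: Balaban1988Convergent, (2.34)-(2.39) p.261] -/
theorem space234_mono {F : MSFrame P i 𝔸} {c : MSConsts} (h0 : 0 ≤ c.β) (h1 : c.β ≤ 1) (hL : 0 < c.L) (hξ : 0 < c.ξ)
    (hBCM : 0 ≤ c.B * c.C * c.M) {α₀ α₀' α₁ α₁' : ℕ → ℝ} (hα₀ : ∀ n, α₀ n ≤ α₀' n) (hα₁ : ∀ n, α₁ n ≤ α₁' n) :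
    space234 𝓜 F c α₀ α₁ ⊆ space234 𝓜 F c α₀' α₁' :=
  fun _ h => satisfies234_mono h0 h1 hL hξ hBCM hα₀ hα₁ h

/-- **The enlarged spaces contain the original ones**: «defined on slightly larger spaces, with the coefficients in their definition bigger
by β multiplied by a corresponding number» (p. 262), e.g. `Ũ^c_{k+1}(Y, (1+β)α̃₀, (1+β)α̃₁)` of (3.43) p. 276 — for a factor `1 + β′`, `β′ ≥ 0`,
and nonnegative sequences. [cite: Balaban1988Convergent, (3.43) p.276] -/
theorem space234_subset_enlarged {F : MSFrame P i 𝔸} {c : MSConsts} (h0 : 0 ≤ c.β) (h1 : c.β ≤ 1) (hL : 0 < c.L)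
    (hξ : 0 < c.ξ) (hBCM : 0 ≤ c.B * c.C * c.M) {α₀ α₁ : ℕ → ℝ} (hα₀ : ∀ n, 0 ≤ α₀ n) (hα₁ : ∀ n, 0 ≤ α₁ n) {β' : ℝ}
    (hβ' : 0 ≤ β') :
    space234 𝓜 F c α₀ α₁ ⊆ space234 𝓜 F c (fun n => (1 + β') * α₀ n) (fun n => (1 + β') * α₁ n) := by
  refine space234_mono h0 h1 hL hξ hBCM (fun n => ?_) (fun n => ?_)
  · have := mul_le_mul_of_nonneg_right (show (1 : ℝ) ≤ 1 + β' by linarith) (hα₀ n); linarith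
  · have := mul_le_mul_of_nonneg_right (show (1 : ℝ) ≤ 1 + β' by linarith) (hα₁ n); linarith

end Conditions

end

end Literature.MathematicalPhysics.QuantumFieldTheory.Balaban1983to89.B14RegularSpaces234
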